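import Summits.ABC.IUTFork.Thm311RealInd1StripTwistLatticeIndex
import Summits.ABC.IUTFork.Thm311RealInd1StripTwistMover
import Literature.NumberTheory.GaloisRepresentations.PadicResidueIndex
import Literature.IUT.LogVolume.FundamentalIdentity
import Literature.IUT.LogVolume.RescaledCompletionInvariants
import HarnessLib

/-!
# [IUTchIII] Thm 3.11 (i) (Ind1) at `v ∈ 𝕍^non`: the Jannsen–Wingberg twists of ALL planes move a closed ball of
# `K_v` whenever `f(v|p)` is ODD and `[K_v : ℚ_p] < e(v|p) + 2g` — the ALL-PLANES parity obstruction

PROOF-ONLY file (abc-iut cell, Cor. 3.12 sub-crew, seat abc-iut-c312-1 = holder of record of the typed [IUTchIII]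
Thm. 3.11, gen 10; row «R11 IND1-STRIP-MOVER-ALL-PLANES», the successor brick named in gen 9's kit
`staging/c312/c312-1/g9/NEXT-ALL-PLANES.md`).  TAKES NO SIDE on [IUTchIII] Cor. 3.12.

Gen 9 (`Thm311RealInd1StripTwistMover`, p467710) proved: ONE twist plane realised in print's (Ind1) strip part moves a
ball as soon as `f(v|p) = 1`.  K. Kondo (arXiv:2512.09231 §2, proof of Thm. 2.3 p. 10; Jannsen–Wingberg = NSW Thm. 7.5.14)
supplies BOTH elementary transvections of EVERY twist plane of ONE `ℚ_p`-basis `y` of `k_+` indexed by `Fin c ⊕ Fin g × Fin 2`,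
`c ≤ 2` (the tree's named fact `DehnTwistTransvectionsOnUnitsAll`, p473922).  With all `g` planes the obstruction survives
for every ODD residue degree:

* §1 (`ℚ_p`): every closed ball `{‖r‖ ≤ ρ}` of `ℚ_p` is `p^n ℤ_p` (`exists_norm_le_iff_norm_le_zpow`), hence
  **`relIndex_ball_padic`**: `[{‖r‖ ≤ ρ} : {‖r‖ ≤ ‖p‖ρ}] = p` (the tree's `resIndex_padic`).
* §2 (any locally compact ultrametric normed `ℚ_p`-algebra field `K`, uniformizer `ϖ`, `e = absRamificationIdx`,
  `p^f = #(𝒪/𝔪)`, `e·f = [K : ℚ_p]` by the tree's `absRamificationIdx_mul_residueDegree`):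
  **`not_forall_twistStable_piBall_of_odd`** — if `f` is ODD and `[K : ℚ_p] < e + 2·#ι` then for NO family of twist pairs
  `(ya i, yb i; ca i, cb i)_{i ∈ ι}` with the Kronecker dualities are all the balls `B_m = ϖ^m 𝒪` stable under all the
  `2·#ι` transvections.  COUNT: along `B_0 ⊋ B_1 ⊋ ⋯ ⊋ B_e`, `[B_m : B_{m+1}] = p^f = [P_m : P_{m+1}]² · [R_m : R_{m+1}]`
  (`relIndex_eq_sq_mul` of `Thm311RealInd1StripTwistLatticeIndex`; `P` = plane coefficient groups, `R` = plane-free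
  remainder), so `f` odd forces `[R_m : R_{m+1}] ≥ p`, i.e. `[P_m : P_{m+1}]²·p ≤ p^f` (`sq_mul_le_pow_of_odd`); but
  `P_m = ∏_i {r : ‖r‖·‖ya i‖ ≤ ‖ϖ‖^m}` (`map_pi_ca_eq_pi`) gives `∏_{m<e} [P_m : P_{m+1}] = [P_0 : P_e] = p^{#ι}` exactly
  (§1), whence `p^{2#ι + e} ≤ p^{ef}`, `2#ι + e ≤ [K : ℚ_p]` — contradiction.  (`f = 1`, one plane: `[K:ℚ_p] = e < e + 2`
  — gen 9's case; all planes: `[K:ℚ_p] = c + 2g ≤ 2 + 2g < 3 + 2g ≤ e + 2g` as soon as `e ≥ 3`.)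
* §3 **AT THE REAL LOG-SHELL** (`K_v` in abc-iut-S7's rescaled norm, `#(𝒪_v/𝔪_v) = p^{f(v|p)}`, `e = e(v|p)`,
  `[K_v : ℚ_p] = e(v|p) f(v|p)` by abc-iut-S7): **`Real.exists_mem_ind1StripOf_image_closedBall_ne_of_planes`** — if elements
  `ψ i, ψ' i` of print's (Ind1) strip part `Real.ind1StripOf v L` act as the transvection pairs of a family of `#ι` twist
  planes (BINDERS; supplied by `DehnTwistTransvectionsOnUnitsAll` in the sequel `Thm311RealInd1StripTwistMoverJWAllOdd`), `f(v|p)`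
  is odd and `e(v|p) f(v|p) < e(v|p) + 2#ι`, then some `χ ∈ Real.ind1StripOf v L` and `m ∈ ℤ` have `χ(𝔪_v^m) ≠ 𝔪_v^m`.

HONEST SCOPE.  As in gen 9: «twist planes realised ⟹ mover» is proved; the realisation is classical (NSW Thm. 7.5.14 +
Kondo §2) and enters the sequel as the named Literature fact.  A statement about OUR typed objects at ONE place; nothing
here asserts or refutes [IUTchIII] Cor. 3.12.  [claim: Mochizuki2012, status: disputed] for every [IUTchIII] quotation;
[cite: NeukirchSchmidtWingberg2008, Thm 7.5.14]; [cite: Kondo2025OuterAutMLF, §2 Thm 2.1 and proof of Thm 2.3 p.10];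
[cite: DupuyHilado2025, §4.7].  typed ≠ proved.
-/

set_option autoImplicit false

noncomputable section

open Metric Set
open scoped Pointwise

namespace Summit.ABC.IUTFork.Thm311.TwistLattice

open Literature.NumberTheory.GaloisRepresentations.Ultrametric Literature.IUT.LogVolume
open Literature.NumberTheory.GaloisRepresentations.Ultrametric.PadicUniformizer

/-! ## 1. Closed balls of `ℚ_p` are the `p^n ℤ_p`; `[B(0,ρ) : B(0,‖p‖ρ)] = p` -/

section Padic

variable (p : ℕ) [Fact p.Prime]

/-- **Every closed ball of `ℚ_p` is some `p^n ℤ_p`**: for `ρ > 0` there is `n ∈ ℤ` with `‖r‖ ≤ ρ ↔ ‖r‖ ≤ ‖p‖^n` for all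
`r ∈ ℚ_p` (`n` = the least integer with `‖p‖^n ≤ ρ`; the value group of `ℚ_p^×` is `‖p‖^ℤ`). [folklore] -/
theorem exists_norm_le_iff_norm_le_zpow {ρ : ℝ} (hρ : 0 < ρ) :
    ∃ n : ℤ, ∀ r : ℚ_[p], ‖r‖ ≤ ρ ↔ ‖r‖ ≤ ‖(p : ℚ_[p])‖ ^ n := by
  have hp0 : 0 < ‖(p : ℚ_[p])‖ := norm_p_pos' p
  have hp1 : ‖(p : ℚ_[p])‖ < 1 := norm_p_lt_one' p
  obtain ⟨N, hN⟩ : ∃ N : ℕ, ‖(p : ℚ_[p])‖ ^ N < ρ := exists_pow_lt_of_lt_one hρ hp1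
  obtain ⟨M, hM⟩ : ∃ M : ℕ, ‖(p : ℚ_[p])‖ ^ M < ρ⁻¹ := exists_pow_lt_of_lt_one (inv_pos.mpr hρ) hp1
  have hbdd : ∃ b : ℤ, ∀ z : ℤ, ‖(p : ℚ_[p])‖ ^ z ≤ ρ → b ≤ z := by
    refine ⟨-(M : ℤ), fun z hz => ?_⟩
    by_contra hlt
    rw [not_le] at hlt
    have h1 : ‖(p : ℚ_[p])‖ ^ (-(M : ℤ)) < ‖(p : ℚ_[p])‖ ^ z :=
      (zpow_lt_zpow_iff_right_of_lt_one₀ hp0 hp1).mpr hlt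
    rw [zpow_neg, zpow_natCast] at h1
    have h2 : ρ < (‖(p : ℚ_[p])‖ ^ M)⁻¹ := by
      rw [lt_inv_comm₀ hρ (pow_pos hp0 M)]; exact hM
    exact absurd (h2.trans (h1.trans_le hz)) (lt_irrefl ρ)
  obtain ⟨n, hn, hmin⟩ := Int.exists_least_of_bdd (P := fun n : ℤ => ‖(p : ℚ_[p])‖ ^ n ≤ ρ) hbdd
    ⟨(N : ℤ), by rw [zpow_natCast]; exact hN.le⟩
  refine ⟨n, fun r => ⟨fun hr => ?_, fun hr => hr.trans hn⟩⟩
  rcases eq_or_ne r 0 with rfl | hr0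
  · rw [norm_zero]; exact zpow_nonneg hp0.le _
  · obtain ⟨k, hk⟩ := (isUniformizer_varpi p).2 (Units.mk0 r hr0)
    rw [Units.val_mk0, varpi_val] at hk
    rw [hk] at hr ⊢
    exact (zpow_le_zpow_iff_right_of_lt_one₀ hp0 hp1).mpr (hmin k hr)

/-- **`[B(0,ρ) : B(0,‖p‖ρ)] = p` in `ℚ_p`**: if the additive subgroups `A ⊇ A'` of `ℚ_p` are the closed balls of radii
`ρ > 0` and `‖p‖·ρ`, then `[A : A'] = p` (both are `p^n ℤ_p ⊋ p^{n+1} ℤ_p`; the tree's `resIndex_padic : [ℤ_p : pℤ_p] = p`).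
[folklore] -/
theorem relIndex_ball_padic {ρ : ℝ} (hρ : 0 < ρ) {A A' : AddSubgroup ℚ_[p]}
    (hA : ∀ r, r ∈ A ↔ ‖r‖ ≤ ρ) (hA' : ∀ r, r ∈ A' ↔ ‖r‖ ≤ ‖(p : ℚ_[p])‖ * ρ) : A'.relIndex A = p := by
  obtain ⟨n, hn⟩ := exists_norm_le_iff_norm_le_zpow p hρ
  have hp0 : 0 < ‖(p : ℚ_[p])‖ := norm_p_pos' p
  have hAeq : A = (piBall (varpi p ^ n) : OpenAddSubgroup ℚ_[p]).toAddSubgroup := by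
    ext r
    rw [hA, hn, mem_toAddSubgroup_piBall, Units.val_zpow_eq_zpow_val, varpi_val, norm_zpow]
  have hA'eq : A' = (piBall (varpi p ^ (n + 1)) : OpenAddSubgroup ℚ_[p]).toAddSubgroup := by
    ext r
    rw [hA', mem_toAddSubgroup_piBall, Units.val_zpow_eq_zpow_val, varpi_val, norm_zpow, zpow_add_one₀ hp0.ne',
      mul_comm (‖(p : ℚ_[p])‖ ^ n), ← inv_mul_le_iff₀ hp0, ← inv_mul_le_iff₀ hp0, ← norm_inv, ← norm_mul]
    exact hn _
  rw [hAeq, hA'eq, relIndex_piBall_zpow_succ, resIndex_padic]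

/-- Arithmetic of one step: if `p^f = t²·r` with `p` prime and `f` ODD then `r ≠ 1`, so `r ≥ p` and `t²·p ≤ p^f`.
[folklore] -/
theorem sq_mul_le_pow_of_odd {p f t r : ℕ} (hp : p.Prime) (hf : Odd f) (h : p ^ f = t ^ 2 * r) :
    t ^ 2 * p ≤ p ^ f := by
  have hr : r ∣ p ^ f := Dvd.intro_left _ h.symm
  obtain ⟨k, -, rfl⟩ := (Nat.dvd_prime_pow hp).mp hr
  rcases k with _ | k
  · exfalso
    rw [pow_zero, mul_one] at h
    have ht : t ∣ p ^ f := Dvd.intro t (by rw [← sq]; exact h.symm)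
    obtain ⟨i, -, rfl⟩ := (Nat.dvd_prime_pow hp).mp ht
    rw [← pow_mul] at h
    have hfi : f = i * 2 := Nat.pow_right_injective hp.two_le h
    exact (Nat.not_even_iff_odd.mpr hf) ⟨i, by omega⟩
  · rw [h]
    exact Nat.mul_le_mul_left _ (Nat.le_self_pow (Nat.succ_ne_zero k) p)

end Padic

/-! ## 2. No family of twist pairs over ALL planes stabilises the ball chain when `f` is odd -/

section Odd

variable (p : ℕ) [Fact p.Prime] {K : Type*} [NontriviallyNormedField K] [NormedAlgebra ℚ_[p] K]
  [IsUltrametricDist K] [ProperSpace K]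

open scoped NormedField in
/-- **The all-planes parity obstruction.**  Let `K` be a locally compact ultrametric normed `ℚ_p`-algebra field with
uniformizer `ϖ`, absolute ramification index `e` and ODD residue degree `f` (`#(𝒪/𝔪) = p^f`), and let
`(ya i, yb i; ca i, cb i)_{i ∈ ι}` be a family of twist planes over `ℚ_p` (`ca i (ya j) = cb i (yb j) = [i=j]`,
`ca i (yb j) = cb i (ya j) = 0`) with `[K : ℚ_p] < e + 2·#ι`.  Then NOT every ball `ϖ^m 𝒪` (`m ∈ ℤ`) is stable under all
the transvections `v ↦ v + cb i v • ya i`, `v ↦ v − ca i v • yb i`.  (Count: `p^f = [B_m:B_{m+1}] = [P_m:P_{m+1}]²·[R_m:R_{m+1}]`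
with `f` odd gives `[P_m:P_{m+1}]²·p ≤ p^f`; the product over `m < e` is `p^{2#ι}·p^e ≤ p^{ef} = p^{[K:ℚ_p]}`.)
[cite: NeukirchSchmidtWingberg2008, Thm 7.5.14] [cite: Kondo2025OuterAutMLF, §2 Thm 2.1 and proof of Thm 2.3 p.10] -/
theorem not_forall_twistStable_piBall_of_odd (hf : Odd (residueDegree p K))
    {ι : Type*} [Fintype ι] [DecidableEq ι]
    (hdim : Module.finrank ℚ_[p] K < absRamificationIdx p K + 2 * Fintype.card ι)
    {ϖ : Kˣ} (hϖ : IsUniformizer ϖ) {ca cb : ι → (K →ₗ[ℚ_[p]] ℚ_[p])} {ya yb : ι → K}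
    (haa : ∀ i j, ca i (ya j) = if i = j then 1 else 0) (hbb : ∀ i j, cb i (yb j) = if i = j then 1 else 0)
    (hab : ∀ i j, ca i (yb j) = 0) (hba : ∀ i j, cb i (ya j) = 0) :
    ¬ ∀ m : ℤ, ∀ i, (∀ v ∈ (piBall (ϖ ^ m) : OpenAddSubgroup K).toAddSubgroup,
          v + cb i v • ya i ∈ (piBall (ϖ ^ m) : OpenAddSubgroup K).toAddSubgroup) ∧
        (∀ v ∈ (piBall (ϖ ^ m) : OpenAddSubgroup K).toAddSubgroup,
          v - ca i v • yb i ∈ (piBall (ϖ ^ m) : OpenAddSubgroup K).toAddSubgroup) := by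
  intro hall
  have hP : p.Prime := Fact.out
  have hef : absRamificationIdx p K * residueDegree p K = Module.finrank ℚ_[p] K :=
    absRamificationIdx_mul_residueDegree p K
  -- the chain `Λ j = B_j = ϖ^j 𝒪`, `j ∈ ℕ`
  let Λ : ℕ → AddSubgroup K := fun j => (piBall (ϖ ^ (j : ℤ)) : OpenAddSubgroup K).toAddSubgroup
  have hΛ : ∀ j : ℕ, Λ j = (piBall (ϖ ^ (j : ℤ)) : OpenAddSubgroup K).toAddSubgroup := fun _ => rfl
  have hanti : ∀ j : ℕ, Λ (j + 1) ≤ Λ j := by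
    intro j
    rw [hΛ, hΛ, Nat.cast_succ]
    exact piBall_zpow_succ_le hϖ.1.le _
  have hst : ∀ j : ℕ, ∀ i, (∀ v ∈ Λ j, v + cb i v • ya i ∈ Λ j) ∧ (∀ v ∈ Λ j, v - ca i v • yb i ∈ Λ j) :=
    fun j => hall _
  have hidx : ∀ j : ℕ, (Λ (j + 1)).relIndex (Λ j) = p ^ residueDegree p K := by
    intro j
    rw [hΛ, hΛ, Nat.cast_succ, relIndex_piBall_zpow_succ, hϖ.resIndex_eq_card_residueField, card_residueField p K]
  -- plane coefficient groups `P j = κa(Λ j) ≤ ℚ_p^ι`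
  let P : ℕ → AddSubgroup (ι → ℚ_[p]) := fun j => (Λ j).map (LinearMap.pi ca).toAddMonoidHom
  have hPdef : ∀ j : ℕ, P j = (Λ j).map (LinearMap.pi ca).toAddMonoidHom := fun _ => rfl
  -- per step: `[P_j : P_{j+1}]² · p ≤ p^f`
  have hstep : ∀ j : ℕ, ((P (j + 1)).relIndex (P j)) ^ 2 * p ≤ p ^ residueDegree p K := by
    intro j
    have h := relIndex_eq_sq_mul haa hbb hab hba (hst j) (hanti j) (hst (j + 1))
    rw [hidx j] at h
    exact sq_mul_le_pow_of_odd hP hf h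
  -- the plane part in total: `[P_0 : P_e] = p^{#ι}`
  have hPpi : ∀ j : ℕ, P j = AddSubgroup.pi Set.univ
      (fun i => (Λ j).comap (LinearMap.toSpanSingleton ℚ_[p] K (ya i)).toAddMonoidHom) :=
    fun j => map_pi_ca_eq_pi haa hbb (hst j)
  have hfac : ∀ i, ((Λ (absRamificationIdx p K)).comap (LinearMap.toSpanSingleton ℚ_[p] K (ya i)).toAddMonoidHom).relIndex
      ((Λ 0).comap (LinearMap.toSpanSingleton ℚ_[p] K (ya i)).toAddMonoidHom) = p := by
    intro i
    have hya0 : ya i ≠ 0 := by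
      intro h0
      have h1 := haa i i
      rw [h0, map_zero, if_pos rfl] at h1
      exact zero_ne_one h1
    have hyapos : 0 < ‖ya i‖ := norm_pos_iff.mpr hya0
    refine relIndex_ball_padic p (ρ := ‖ya i‖⁻¹) (inv_pos.mpr hyapos) (fun r => ?_) (fun r => ?_)
    · rw [AddSubgroup.mem_comap, LinearMap.toAddMonoidHom_coe, LinearMap.toSpanSingleton_apply, hΛ,
        mem_toAddSubgroup_piBall, Nat.cast_zero, zpow_zero, Units.val_one, norm_one, norm_smul,
        ← le_div_iff₀ hyapos, one_div]
    · rw [AddSubgroup.mem_comap, LinearMap.toAddMonoidHom_coe, LinearMap.toSpanSingleton_apply, hΛ,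
        mem_toAddSubgroup_piBall, zpow_natCast, Units.val_pow_eq_pow_val, norm_pow,
        ← norm_prime_eq_norm_pow p K hϖ, norm_natCast_eq_padicNorm p K p, norm_smul, ← le_div_iff₀ hyapos,
        div_eq_mul_inv]
  have hPtot : (P (absRamificationIdx p K)).relIndex (P 0) = p ^ Fintype.card ι := by
    rw [hPpi, hPpi, relIndex_pi]
    rw [Finset.prod_congr rfl fun i _ => hfac i, Finset.prod_const, Finset.card_univ]
  have hprod : ∏ j ∈ Finset.range (absRamificationIdx p K), (P (j + 1)).relIndex (P j) = p ^ Fintype.card ι := by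
    rw [← relIndex_chain_eq_prod P (absRamificationIdx p K) (fun j _ => AddSubgroup.map_mono (hanti j)), hPtot]
  -- `(p^{#ι})² · p^e ≤ (p^f)^e`
  have hineq : (p ^ Fintype.card ι) ^ 2 * p ^ absRamificationIdx p K ≤
      (p ^ residueDegree p K) ^ absRamificationIdx p K := by
    calc (p ^ Fintype.card ι) ^ 2 * p ^ absRamificationIdx p K
        = ∏ j ∈ Finset.range (absRamificationIdx p K), (((P (j + 1)).relIndex (P j)) ^ 2 * p) := by
          rw [Finset.prod_mul_distrib, Finset.prod_pow, hprod, Finset.prod_const, Finset.card_range]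
      _ ≤ ∏ j ∈ Finset.range (absRamificationIdx p K), p ^ residueDegree p K :=
          Finset.prod_le_prod' fun j _ => hstep j
      _ = (p ^ residueDegree p K) ^ absRamificationIdx p K := by rw [Finset.prod_const, Finset.card_range]
  rw [← pow_mul, ← pow_add, ← pow_mul, Nat.pow_le_pow_iff_right hP.one_lt, mul_comm (residueDegree p K),
    hef] at hineq
  omega

open scoped NormedField in
/-- **Hence SOME ball is MOVED by SOME transvection of SOME plane** (if each of the `2·#ι` maps sends every `B_m` onto
itself, all balls are stable). [cite: NeukirchSchmidtWingberg2008, Thm 7.5.14]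
[cite: Kondo2025OuterAutMLF, §2 Thm 2.1 and proof of Thm 2.3 p.10] -/
theorem exists_transvection_image_piBall_ne_of_odd (hf : Odd (residueDegree p K))
    {ι : Type*} [Fintype ι] [DecidableEq ι]
    (hdim : Module.finrank ℚ_[p] K < absRamificationIdx p K + 2 * Fintype.card ι)
    {ϖ : Kˣ} (hϖ : IsUniformizer ϖ) {ca cb : ι → (K →ₗ[ℚ_[p]] ℚ_[p])} {ya yb : ι → K}
    (haa : ∀ i j, ca i (ya j) = if i = j then 1 else 0) (hbb : ∀ i j, cb i (yb j) = if i = j then 1 else 0)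
    (hab : ∀ i j, ca i (yb j) = 0) (hba : ∀ i j, cb i (ya j) = 0) (T T' : ι → K → K)
    (hT : ∀ i v, T i v = v + cb i v • ya i) (hT' : ∀ i v, T' i v = v - ca i v • yb i) :
    ∃ i, ∃ m : ℤ, T i '' closedBall (0 : K) (‖(ϖ : K)‖ ^ m) ≠ closedBall (0 : K) (‖(ϖ : K)‖ ^ m) ∨
      T' i '' closedBall (0 : K) (‖(ϖ : K)‖ ^ m) ≠ closedBall (0 : K) (‖(ϖ : K)‖ ^ m) := by
  by_contra hcon
  push Not at hcon
  apply not_forall_twistStable_piBall_of_odd p hf hdim hϖ haa hbb hab hba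
  intro m i
  obtain ⟨h1, h2⟩ := hcon i m
  have hball : ∀ x : K, x ∈ (piBall (ϖ ^ m) : OpenAddSubgroup K).toAddSubgroup ↔
      x ∈ closedBall (0 : K) (‖(ϖ : K)‖ ^ m) := by
    intro x
    rw [mem_toAddSubgroup_piBall, mem_closedBall_zero_iff, Units.val_zpow_eq_zpow_val, norm_zpow]
  refine ⟨fun v hv => ?_, fun v hv => ?_⟩
  · rw [hball] at hv ⊢
    rw [← hT, ← h1]
    exact Set.mem_image_of_mem (T i) hv
  · rw [hball] at hv ⊢
    rw [← hT', ← h2]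
    exact Set.mem_image_of_mem (T' i) hv

end Odd

end Summit.ABC.IUTFork.Thm311.TwistLattice

/-! ## 3. At the real log-shell `K_v`: twist planes inside print's (Ind1) strip part move a ball (`f(v|p)` odd) -/

namespace Summit.ABC.IUTFork.Thm311.Real

open NumberField IsDedekindDomain Literature.NumberTheory.NumberFields Literature.IUT.LogVolume
open Literature.NumberTheory.GaloisRepresentations.Ultrametric Summit.ABC.IUTFork.Thm311.TwistLattice

variable {F : Type} [Field F] [NumberField F] (p : ℕ) [Fact p.Prime] (v : HeightOneSpectrum (𝓞 F))
  (hv : ((p : ℕ) : 𝓞 F) ∈ v.asIdeal)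

/-- **PRINT'S (Ind1) STRIP PART MOVES A BALL once it realises the twist pairs of enough planes, at ODD `f(v|p)`.**
Let `v ∣ p` be a finite place of `F` with `f(v|p)` odd, read `K_v` in abc-iut-S7's rescaled norm (`K := RescaledCompletion
F p v hv`, the identity `of : K_v ≃+* K`), and let `ψ i, ψ' i ∈ Real.ind1StripOf v L` (`i ∈ ι`) — elements of print's (Ind1)
strip part at `v` — act on `K` as the transvection pairs of a family of twist planes `(ya i, yb i; ca i, cb i)` over `ℚ_p`
(BINDERS `hT, hT'`; by Kondo arXiv:2512.09231 §2 / NSW Thm. 7.5.14 the Jannsen–Wingberg twists supply `g` such planes of a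
basis `Fin c ⊕ Fin g × Fin 2`, `c ≤ 2`, whenever `p` is odd and `[K_v : ℚ_p] ≥ 3`), with `e(v|p)·f(v|p) < e(v|p) + 2·#ι`.  Then
for some `χ ∈ Real.ind1StripOf v L` and some `m ∈ ℤ` the closed ball `B(0, ‖ϖ‖^m) = 𝔪_v^m` is NOT mapped onto itself.
Contrast: print's (Ind2) moves no ball (`image_closedBall_eq_of_mem_ismIsm`), Dupuy–Hilado's (Ind1) is `{1}`.
[claim: Mochizuki2012, status: disputed] [cite: NeukirchSchmidtWingberg2008, Thm 7.5.14] [cite: DupuyHilado2025, §4.7] -/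
theorem exists_mem_ind1StripOf_image_closedBall_ne_of_planes (hfodd : Odd (v.asIdeal.inertiaDeg ℤ))
    (L : Additive (↥(v.adicCompletionIntegers F))ˣ →+ v.adicCompletion F)
    {ϖ : (RescaledCompletion F p v hv)ˣ} (hϖ : IsUniformizer ϖ)
    {ι : Type*} [Fintype ι] [DecidableEq ι] (hdim : localDeg F v < v.asIdeal.ramificationIdx ℤ + 2 * Fintype.card ι)
    {ca cb : ι → (RescaledCompletion F p v hv →ₗ[ℚ_[p]] ℚ_[p])} {ya yb : ι → RescaledCompletion F p v hv}
    (haa : ∀ i j, ca i (ya j) = if i = j then 1 else 0) (hbb : ∀ i j, cb i (yb j) = if i = j then 1 else 0)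
    (hab : ∀ i j, ca i (yb j) = 0) (hba : ∀ i j, cb i (ya j) = 0)
    {ψ ψ' : ι → (v.adicCompletion F ≃+ v.adicCompletion F)} (hψ : ∀ i, ψ i ∈ ind1StripOf v L)
    (hψ' : ∀ i, ψ' i ∈ ind1StripOf v L)
    (hT : ∀ i (x : RescaledCompletion F p v hv),
      RescaledCompletion.of F p v hv (ψ i ((RescaledCompletion.of F p v hv).symm x)) = x + cb i x • ya i)
    (hT' : ∀ i (x : RescaledCompletion F p v hv),
      RescaledCompletion.of F p v hv (ψ' i ((RescaledCompletion.of F p v hv).symm x)) = x - ca i x • yb i) :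
    ∃ χ ∈ ind1StripOf v L, ∃ m : ℤ,
      (fun x => RescaledCompletion.of F p v hv (χ ((RescaledCompletion.of F p v hv).symm x))) ''
          closedBall (0 : RescaledCompletion F p v hv) (‖(ϖ : RescaledCompletion F p v hv)‖ ^ m) ≠
        closedBall (0 : RescaledCompletion F p v hv) (‖(ϖ : RescaledCompletion F p v hv)‖ ^ m) := by
  -- `f(K_v) = f(v|p)`, `e(K_v) = e(v|p)`, `[K_v : ℚ_p] = e(v|p) f(v|p)` (abc-iut-S7)
  have hf : Odd (residueDegree p (RescaledCompletion F p v hv)) := by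
    rw [residueDegree_rescaledCompletion F p v hv]; exact hfodd
  have hfin : Module.finrank ℚ_[p] (RescaledCompletion F p v hv) = localDeg F v :=
    (RescaledCompletion.localDeg_eq_finrank F p v hv).symm
  have hd : Module.finrank ℚ_[p] (RescaledCompletion F p v hv) <
      absRamificationIdx p (RescaledCompletion F p v hv) + 2 * Fintype.card ι := by
    rw [absRamificationIdx_rescaledCompletion F p v hv, hfin]
    exact hdim
  obtain ⟨i, m, hm⟩ := exists_transvection_image_piBall_ne_of_odd p (K := RescaledCompletion F p v hv) hf hd hϖ
    haa hbb hab hba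
    (fun i x => RescaledCompletion.of F p v hv (ψ i ((RescaledCompletion.of F p v hv).symm x)))
    (fun i x => RescaledCompletion.of F p v hv (ψ' i ((RescaledCompletion.of F p v hv).symm x))) hT hT'
  rcases hm with h | h
  · exact ⟨ψ i, hψ i, m, h⟩
  · exact ⟨ψ' i, hψ' i, m, h⟩

end Summit.ABC.IUTFork.Thm311.Real

end
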